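import Mathlib
import Summits.KontsevichZagierPeriods.KontsevichZagierPeriods.Theorems.InverseLandauTateLiftingRatChart
import Summits.KontsevichZagierPeriods.KontsevichZagierPeriods.Theorems.InverseLandauTateLiftingRatCompose
import Summits.KontsevichZagierPeriods.KontsevichZagierPeriods.Theorems.InverseLandauTateLiftingConicChart
import Summits.KontsevichZagierPeriods.KontsevichZagierPeriods.Theorems.InverseLandauTateLiftingConicDegenerate
import Summits.KontsevichZagierPeriods.KontsevichZagierPeriods.Theorems.InverseLandauTateLiftingRootChart

/-!
# `TateLifting` (stmt-KontsevichZagierPeriods-9129), line `Sketch` — the genus-zero sector (reductions, kernel form)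

THE RATIONAL-CHART PRINCIPLE (continuation lead c7). A dimension-one representation `r = [σ, f]` is reduced to the
landed dimension-≤-1 algebraic sector (`kzKernelConjecture_lowDimAlg`: point representations and representations
read by `p(x)/q(x)`, `p, q ∈ ℝ[x]` with real-algebraic coefficients — Baker inside the calculus) by ONE change of
variables (Kontsevich–Zagier's rule (2)) as soon as there is a new variable `t = ψ(x)`, `ℚ`-semialgebraic on `σ`,
with a RATIONAL inverse chart `x = X(t) ∈ K(t)` over `K = ℚ̄ ∩ ℝ = algebraicClosure ℚ ℝ` and a rational
pull-back `G ∈ K(t)` of the integrand (`tateLifting_ratChart`; the algebra `P(X(t), Y(t)) ∈ K(t)` is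
`tateLifting_ratCompose`). Fed with the two classical unirational parametrisations — Euler's secant substitution
`t = (√q(x) − y₀)/(x − x₀)` through a `K`-point of a CONIC `y² = q(x) = ax² + bx + c`, `b² ≠ 4ac`
(`tateLifting_conicChart`; the point is `(x₀, √q(x₀))` for a rational abscissa `x₀` with `q(x₀) > 0`, after the
null line `{x = x₀}` is removed; degenerate conics are piecewise rational, `tateLifting_conicDegenerate`), and
`t = ⁿ√((ax + b)/(cx + e))`, `x = (etⁿ − b)/(a − ctⁿ)` for the RADICALS of linear fractions
(`tateLifting_rootChart`) — it gives `genusZeroLowDimKernel`: **the kernel form of Conjecture 1 on the subgroup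
generated by the point representations, the algebraic-coefficient rational representations of dimension one, ALL
conic representations `[σ, R(x, √q(x))]` and the radical representations `[σ, R(x, ⁿ√((ax+b)/(cx+e)))]` over
`K`**. The crux on this sector, pair forms and the conic bands (areas) are in
`Theorems/InverseLandauTateLiftingGenusZeroBands.lean` / `…GenusZeroLunes.lean`.

References: M. Kontsevich, D. Zagier, *Periods* (2001), §1.2; L. Euler, *Institutiones calculi integralis* I
(1768), Cap. II (Euler's substitutions); A. Baker, *Transcendental Number Theory* (1975), Thm 2.1.
-/


noncomputable section

open MeasureTheory Set
open Literature.NumberTheory.Transcendental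
open Literature.ModelTheory.ExponentialFields (IsSemialgebraic)
open Summit.KontsevichZagierPeriods.HyperbolicBloch.OffTetraSectorKernel (rungZero_isAlgebraic_sqrt)

namespace Summit.KontsevichZagierPeriods.InverseLandau

namespace GenusZero

/-- **Generic genus-zero reduction from a rational chart** (`tateLifting_ratChart` +
`tateLifting_ratCompose`): if `t = ψ(x)` is
`ℚ`-semialgebraic on `σ`, `X = p_X/q_X`, `Y = p_Y/q_Y ∈ K(t)` satisfy `X(ψ x) = x` on `σ`, and the integrand is
`P(x, Y(ψ x))/Q(x, Y(ψ x))` on `σ` (`Q ≠ 0` there), then `[σ, f]` reduces to the low-dimensional algebraic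
sector modulo relations. [cite: KontsevichZagier2001, §1.2 rule (2)] -/
theorem chart_reduce (r : KZ.IntegralRep 1) (ψ : ℝ → ℝ)
    (pX qX pY qY : Polynomial (algebraicClosure ℚ ℝ)) (P Q : MvPolynomial (Fin 2) (algebraicClosure ℚ ℝ))
    (hψ : IsSemialgebraicFunOn ℚ r.domain (fun x => ψ (x 0)))
    (hqX : ∀ x ∈ r.domain, (Polynomial.aeval (ψ (x 0)) qX : ℝ) ≠ 0)
    (hqY : ∀ x ∈ r.domain, (Polynomial.aeval (ψ (x 0)) qY : ℝ) ≠ 0)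
    (hX : ∀ x ∈ r.domain, (Polynomial.aeval (ψ (x 0)) pX : ℝ) / Polynomial.aeval (ψ (x 0)) qX = x 0)
    (hQ : ∀ x ∈ r.domain, (MvPolynomial.aeval
      ![x 0, (Polynomial.aeval (ψ (x 0)) pY : ℝ) / Polynomial.aeval (ψ (x 0)) qY] Q : ℝ) ≠ 0)
    (hf : ∀ x ∈ r.domain, r.integrand x =
      (MvPolynomial.aeval ![x 0, (Polynomial.aeval (ψ (x 0)) pY : ℝ) / Polynomial.aeval (ψ (x 0)) qY] P : ℝ) /
        MvPolynomial.aeval ![x 0, (Polynomial.aeval (ψ (x 0)) pY : ℝ) / Polynomial.aeval (ψ (x 0)) qY] Q) :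
    ∃ ℓ ∈ AddSubgroup.closure
        {d : KZ.FormalRep | (∃ r : KZ.IntegralRep 0, d = KZ.of r) ∨
            ∃ (r : KZ.IntegralRep 1) (p q : Polynomial ℝ), (∀ i, IsAlgebraic ℚ (p.coeff i)) ∧
              (∀ i, IsAlgebraic ℚ (q.coeff i)) ∧ (∀ x ∈ r.domain, q.eval (x 0) ≠ 0) ∧
              Set.EqOn r.integrand (fun x => p.eval (x 0) / q.eval (x 0)) r.domain ∧ d = KZ.of r},
      KZ.of r - ℓ ∈ KZ.relations := by
  obtain ⟨pP, NP, hP⟩ := tateLifting_ratCompose P pX qX pY qY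
  obtain ⟨pQ, NQ, hPQ⟩ := tateLifting_ratCompose Q pX qX pY qY
  have hD : ∀ x ∈ r.domain, (Polynomial.aeval (ψ (x 0)) (qX * qY) : ℝ) ≠ 0 := fun x hx => by
    rw [map_mul]
    exact mul_ne_zero (hqX x hx) (hqY x hx)
  -- along the chart, `(x, Y(ψ x)) = (X(ψ x), Y(ψ x))`
  have hvec : ∀ x ∈ r.domain,
      (![x 0, (Polynomial.aeval (ψ (x 0)) pY : ℝ) / Polynomial.aeval (ψ (x 0)) qY] : Fin 2 → ℝ) =
        ![(Polynomial.aeval (ψ (x 0)) pX : ℝ) / Polynomial.aeval (ψ (x 0)) qX,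
          (Polynomial.aeval (ψ (x 0)) pY : ℝ) / Polynomial.aeval (ψ (x 0)) qY] := fun x hx => by
    rw [hX x hx]
  have hpQ : ∀ x ∈ r.domain, (Polynomial.aeval (ψ (x 0)) pQ : ℝ) ≠ 0 := fun x hx h0 => by
    have h := hPQ (ψ (x 0)) (hqX x hx) (hqY x hx)
    rw [← hvec x hx, h0, zero_div] at h
    exact hQ x hx h
  refine tateLifting_ratChart r ψ pX qX (pP * (qX * qY) ^ NQ) (pQ * (qX * qY) ^ NP) hψ hqX hX ?_ ?_
  · intro x hx
    rw [map_mul, map_pow]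
    exact mul_ne_zero (hpQ x hx) (pow_ne_zero _ (hD x hx))
  · intro x hx
    rw [hf x hx, hvec x hx, hP (ψ (x 0)) (hqX x hx) (hqY x hx), hPQ (ψ (x 0)) (hqX x hx) (hqY x hx)]
    have h1 := hqX x hx
    have h1' := hqY x hx
    have h2 := hpQ x hx
    simp only [map_mul, map_pow]
    field_simp

/-- The conic chart polynomials read at a real point (`q = X² − a`, `p_X`, `p_Y`). [folklore] -/
theorem conic_aeval_charts (a b x₀ y₀ : algebraicClosure ℚ ℝ) (t : ℝ) :
    (Polynomial.aeval t (Polynomial.X ^ 2 - Polynomial.C a : Polynomial (algebraicClosure ℚ ℝ)) : ℝ) =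
        t ^ 2 - a ∧
      (Polynomial.aeval t (Polynomial.C x₀ * (Polynomial.X ^ 2 - Polynomial.C a) +
          (Polynomial.C (a * x₀ + a * x₀ + b) - Polynomial.C (y₀ + y₀) * Polynomial.X) :
            Polynomial (algebraicClosure ℚ ℝ)) : ℝ) =
        (x₀ : ℝ) * (t ^ 2 - a) + ((2 * (a : ℝ) * x₀ + b) - 2 * (y₀ : ℝ) * t) ∧
      (Polynomial.aeval t (Polynomial.C y₀ * (Polynomial.X ^ 2 - Polynomial.C a) +
          Polynomial.X * (Polynomial.C (a * x₀ + a * x₀ + b) - Polynomial.C (y₀ + y₀) * Polynomial.X) :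
            Polynomial (algebraicClosure ℚ ℝ)) : ℝ) =
        (y₀ : ℝ) * (t ^ 2 - a) + t * ((2 * (a : ℝ) * x₀ + b) - 2 * (y₀ : ℝ) * t) := by
  refine ⟨?_, ?_, ?_⟩
  · simp [Polynomial.aeval_def, Polynomial.eval₂_sub, IntermediateField.algebraMap_apply]
  · simp only [Polynomial.aeval_def, Polynomial.eval₂_add, Polynomial.eval₂_sub, Polynomial.eval₂_mul,
      Polynomial.eval₂_pow, Polynomial.eval₂_C, Polynomial.eval₂_X, IntermediateField.algebraMap_apply,
      AddMemClass.coe_add, MulMemClass.coe_mul]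
    ring
  · simp only [Polynomial.aeval_def, Polynomial.eval₂_add, Polynomial.eval₂_sub, Polynomial.eval₂_mul,
      Polynomial.eval₂_pow, Polynomial.eval₂_C, Polynomial.eval₂_X, IntermediateField.algebraMap_apply,
      AddMemClass.coe_add, MulMemClass.coe_mul]
    ring

/-- **Conic reduction away from a base point** (`tateLifting_conicChart` + `chart_reduce`): a conic
representation with `b² ≠ 4ac`, whose
domain misses the abscissa `x₀` of a point `(x₀, y₀) ∈ K²` of the conic, reduces to the low-dimensional
algebraic sector (Euler's secant substitution `t = (√q(x) − y₀)/(x − x₀)`, then the rational chart).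
[cite: KontsevichZagier2001, §1.2 rule (2)] -/
theorem conic_reduce_core (a b c x₀ y₀ : algebraicClosure ℚ ℝ) (P Q : MvPolynomial (Fin 2) (algebraicClosure ℚ ℝ))
    (r : KZ.IntegralRep 1)
    (hy₀ : (y₀ : ℝ) ^ 2 = (a : ℝ) * (x₀ : ℝ) ^ 2 + (b : ℝ) * (x₀ : ℝ) + c)
    (hdisc : (b : ℝ) ^ 2 - 4 * (a : ℝ) * c ≠ 0) (hx₀ : ∀ x ∈ r.domain, x 0 ≠ (x₀ : ℝ))
    (hpos : ∀ x ∈ r.domain, 0 < (a : ℝ) * x 0 ^ 2 + (b : ℝ) * x 0 + c)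
    (hQ : ∀ x ∈ r.domain,
      (MvPolynomial.aeval ![x 0, Real.sqrt ((a : ℝ) * x 0 ^ 2 + (b : ℝ) * x 0 + c)] Q : ℝ) ≠ 0)
    (hint : Set.EqOn r.integrand (fun x =>
      (MvPolynomial.aeval ![x 0, Real.sqrt ((a : ℝ) * x 0 ^ 2 + (b : ℝ) * x 0 + c)] P : ℝ) /
        MvPolynomial.aeval ![x 0, Real.sqrt ((a : ℝ) * x 0 ^ 2 + (b : ℝ) * x 0 + c)] Q) r.domain) :
    ∃ ℓ ∈ AddSubgroup.closure
        {d : KZ.FormalRep | (∃ r : KZ.IntegralRep 0, d = KZ.of r) ∨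
            ∃ (r : KZ.IntegralRep 1) (p q : Polynomial ℝ), (∀ i, IsAlgebraic ℚ (p.coeff i)) ∧
              (∀ i, IsAlgebraic ℚ (q.coeff i)) ∧ (∀ x ∈ r.domain, q.eval (x 0) ≠ 0) ∧
              Set.EqOn r.integrand (fun x => p.eval (x 0) / q.eval (x 0)) r.domain ∧ d = KZ.of r},
      KZ.of r - ℓ ∈ KZ.relations := by
  obtain ⟨hψ, hid⟩ := tateLifting_conicChart a b c x₀ y₀ r.domain r.isSemialgebraic_domain hy₀ hdisc hx₀ hpos
  -- the secant slope and the chart polynomials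
  set ψ : ℝ → ℝ := fun s => (Real.sqrt ((a : ℝ) * s ^ 2 + (b : ℝ) * s + c) - y₀) / (s - x₀) with hψ_def
  set qX : Polynomial (algebraicClosure ℚ ℝ) := Polynomial.X ^ 2 - Polynomial.C a with hqX_def
  set pX : Polynomial (algebraicClosure ℚ ℝ) := Polynomial.C x₀ * (Polynomial.X ^ 2 - Polynomial.C a) +
    (Polynomial.C (a * x₀ + a * x₀ + b) - Polynomial.C (y₀ + y₀) * Polynomial.X) with hpX_def
  set pY : Polynomial (algebraicClosure ℚ ℝ) := Polynomial.C y₀ * (Polynomial.X ^ 2 - Polynomial.C a) +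
    Polynomial.X * (Polynomial.C (a * x₀ + a * x₀ + b) - Polynomial.C (y₀ + y₀) * Polynomial.X) with hpY_def
  have hq : ∀ x ∈ r.domain, (Polynomial.aeval (ψ (x 0)) qX : ℝ) ≠ 0 := fun x hx => by
    rw [(conic_aeval_charts a b x₀ y₀ _).1]
    exact (hid x hx).1
  have hXx : ∀ x ∈ r.domain,
      (Polynomial.aeval (ψ (x 0)) pX : ℝ) / Polynomial.aeval (ψ (x 0)) qX = x 0 := fun x hx => by
    have h1 := (hid x hx).1
    have h2 := (hid x hx).2.1
    rw [(conic_aeval_charts a b x₀ y₀ _).1, (conic_aeval_charts a b x₀ y₀ _).2.1]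
    simp only [hψ_def] at h1 h2 ⊢
    generalize (Real.sqrt ((a : ℝ) * x 0 ^ 2 + (b : ℝ) * x 0 + c) - y₀) / (x 0 - x₀) = T at h1 h2 ⊢
    refine Eq.trans ?_ h2
    field_simp
  have hYx : ∀ x ∈ r.domain,
      (Polynomial.aeval (ψ (x 0)) pY : ℝ) / Polynomial.aeval (ψ (x 0)) qX =
        Real.sqrt ((a : ℝ) * x 0 ^ 2 + (b : ℝ) * x 0 + c) := fun x hx => by
    have h1 := (hid x hx).1
    have h2 := (hid x hx).2.1
    have h4 := (hid x hx).2.2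
    rw [(conic_aeval_charts a b x₀ y₀ _).1, (conic_aeval_charts a b x₀ y₀ _).2.2]
    simp only [hψ_def] at h1 h2 h4 ⊢
    generalize (Real.sqrt ((a : ℝ) * x 0 ^ 2 + (b : ℝ) * x 0 + c) - y₀) / (x 0 - x₀) = T at h1 h2 h4 ⊢
    -- `x 0 − x₀ = (2ax₀ + b − 2y₀T)/(T² − a)` from the chart identity
    have h3 : (2 * (a : ℝ) * x₀ + b - 2 * (y₀ : ℝ) * T) / (T ^ 2 - a) = x 0 - (x₀ : ℝ) := by
      rw [eq_sub_iff_add_eq', h2]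
    rw [← h4, ← h3]
    field_simp
  refine chart_reduce r ψ pX qX pY qX P Q hψ hq hq hXx (fun x hx => ?_) (fun x hx => ?_)
  · rw [hYx x hx]; exact hQ x hx
  · rw [hYx x hx]; exact hint hx

/-- A real quadratic positive somewhere is positive at a rational abscissa (continuity, density). [folklore] -/
theorem exists_rat_quadratic_pos {a b c s : ℝ} (h : 0 < a * s ^ 2 + b * s + c) :
    ∃ x₀ : ℚ, 0 < a * (x₀ : ℝ) ^ 2 + b * x₀ + c := by
  have hcont : ContinuousAt (fun u : ℝ => a * u ^ 2 + b * u + c) s := by fun_prop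
  obtain ⟨ε, hε, hball⟩ := Metric.eventually_nhds_iff.1 (hcont.eventually (lt_mem_nhds h))
  obtain ⟨x₀, h1, h2⟩ := exists_rat_btwn (show s - ε < s + ε by linarith)
  refine ⟨x₀, hball ?_⟩
  rw [Real.dist_eq, abs_lt]
  constructor <;> linarith

/-- **Reduction of the conic generators** (all conics): every conic representation reduces to the
low-dimensional algebraic sector modulo relations — degenerate conics by `tateLifting_conicDegenerate`;
otherwise choose a rational
abscissa `x₀` with `q(x₀) > 0` (the domain is non-empty, `q` is continuous, `ℚ` is dense), the point
`(x₀, √q(x₀)) ∈ K²` of the conic, remove the null line `{x = x₀}` from the domain (co-null restriction) and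
apply Euler's secant substitution. [cite: KontsevichZagier2001, §1.2] -/
theorem conic_reduce :
    ∀ d ∈ {d : KZ.FormalRep | ∃ (a b c : algebraicClosure ℚ ℝ)
              (P Q : MvPolynomial (Fin 2) (algebraicClosure ℚ ℝ)) (r : KZ.IntegralRep 1),
            (∀ x ∈ r.domain, 0 < (a : ℝ) * x 0 ^ 2 + (b : ℝ) * x 0 + c) ∧
            (∀ x ∈ r.domain,
              (MvPolynomial.aeval ![x 0, Real.sqrt ((a : ℝ) * x 0 ^ 2 + (b : ℝ) * x 0 + c)] Q : ℝ) ≠ 0) ∧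
            Set.EqOn r.integrand (fun x =>
              (MvPolynomial.aeval ![x 0, Real.sqrt ((a : ℝ) * x 0 ^ 2 + (b : ℝ) * x 0 + c)] P : ℝ) /
                MvPolynomial.aeval ![x 0, Real.sqrt ((a : ℝ) * x 0 ^ 2 + (b : ℝ) * x 0 + c)] Q) r.domain ∧
            d = KZ.of r},
      ∃ ℓ ∈ AddSubgroup.closure
        {d : KZ.FormalRep | (∃ r : KZ.IntegralRep 0, d = KZ.of r) ∨
            ∃ (r : KZ.IntegralRep 1) (p q : Polynomial ℝ), (∀ i, IsAlgebraic ℚ (p.coeff i)) ∧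
              (∀ i, IsAlgebraic ℚ (q.coeff i)) ∧ (∀ x ∈ r.domain, q.eval (x 0) ≠ 0) ∧
              Set.EqOn r.integrand (fun x => p.eval (x 0) / q.eval (x 0)) r.domain ∧ d = KZ.of r},
      d - ℓ ∈ KZ.relations := by
  rintro d ⟨a, b, c, P, Q, r, hpos, hQ, hint, rfl⟩
  by_cases hdisc : (b : ℝ) ^ 2 - 4 * (a : ℝ) * c = 0
  · exact tateLifting_conicDegenerate a b c P Q r hdisc hpos hQ hint
  rcases r.domain.eq_empty_or_nonempty with hempty | ⟨x, hx⟩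
  · exact ⟨0, AddSubgroup.zero_mem _, by
      rw [sub_zero]; exact KZ.of_mem_relations_of_volume_eq_zero r (by rw [hempty, measure_empty])⟩
  -- a rational base point of the conic
  obtain ⟨x₀, hx₀⟩ := exists_rat_quadratic_pos (hpos x hx)
  have hx₀K : ((x₀ : ℝ)) ∈ algebraicClosure ℚ ℝ := mem_algebraicClosure_iff.2 (isAlgebraic_algebraMap x₀)
  have hqK : (a : ℝ) * (x₀ : ℝ) ^ 2 + (b : ℝ) * x₀ + c ∈ algebraicClosure ℚ ℝ :=
    add_mem (add_mem (mul_mem a.2 (pow_mem hx₀K 2)) (mul_mem b.2 hx₀K)) c.2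
  have hy₀K : Real.sqrt ((a : ℝ) * (x₀ : ℝ) ^ 2 + (b : ℝ) * x₀ + c) ∈ algebraicClosure ℚ ℝ :=
    mem_algebraicClosure_iff.2 (rungZero_isAlgebraic_sqrt (mem_algebraicClosure_iff.1 hqK))
  set X₀ : algebraicClosure ℚ ℝ := ⟨(x₀ : ℝ), hx₀K⟩ with hX₀
  set Y₀ : algebraicClosure ℚ ℝ := ⟨Real.sqrt ((a : ℝ) * (x₀ : ℝ) ^ 2 + (b : ℝ) * x₀ + c), hy₀K⟩ with hY₀
  have hy₀ : (Y₀ : ℝ) ^ 2 = (a : ℝ) * (X₀ : ℝ) ^ 2 + (b : ℝ) * (X₀ : ℝ) + c := by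
    show Real.sqrt ((a : ℝ) * (x₀ : ℝ) ^ 2 + (b : ℝ) * x₀ + c) ^ 2 = (a : ℝ) * (x₀ : ℝ) ^ 2 + (b : ℝ) * x₀ + c
    exact Real.sq_sqrt hx₀.le
  -- remove the null line `{x = x₀}`
  set E : Set (Fin 1 → ℝ) := r.domain ∩ {x | x 0 ≠ (x₀ : ℝ)} with hE_def
  have hne : IsSemialgebraic ℚ {x : Fin 1 → ℝ | x 0 ≠ (x₀ : ℝ)} := by
    have h := (Literature.ModelTheory.ExponentialFields.isSemialgebraic_setOf_eval_eq_zero (k := ℚ) (R := ℝ)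
      (MvPolynomial.X 0 - MvPolynomial.C x₀ : MvPolynomial (Fin 1) ℚ)).compl
    convert h using 1
    ext x
    simp [sub_eq_zero]
  have hE : IsSemialgebraic ℚ E := r.isSemialgebraic_domain.inter hne
  have hEsub : E ⊆ r.domain := inter_subset_left
  have hvol : volume (r.domain \ E) = 0 := by
    refine measure_mono_null (fun x hx => ?_) (KZ.volume_setOf_last_eq_zero (n := 0) (x₀ : ℝ))
    have h2 : x ∉ E := hx.2
    rw [hE_def, mem_inter_iff, not_and, mem_setOf_eq, not_not] at h2
    exact h2 hx.1
  have h1 := r.of_sub_of_restrict_mem_relations hE hEsub hvol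
  obtain ⟨ℓ, hℓ, h2⟩ := conic_reduce_core a b c X₀ Y₀ P Q (r.restrict E hE hEsub) hy₀ hdisc
    (fun x hx => hx.2) (fun x hx => hpos x hx.1) (fun x hx => hQ x hx.1) (fun x hx => hint hx.1)
  refine ⟨ℓ, hℓ, ?_⟩
  have h := KZ.relations.add_mem h1 h2
  rwa [sub_add_sub_cancel] at h

/-- **Reduction of the radical generators** (`tateLifting_rootChart` + `chart_reduce`; `Y = t`).
[cite: KontsevichZagier2001, §1.2 rule (2)] -/
theorem root_reduce :
    ∀ d ∈ {d : KZ.FormalRep | ∃ (n : ℕ) (a b c e : algebraicClosure ℚ ℝ)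
              (P Q : MvPolynomial (Fin 2) (algebraicClosure ℚ ℝ)) (r : KZ.IntegralRep 1),
            0 < n ∧ (a : ℝ) * e - b * c ≠ 0 ∧
            (∀ x ∈ r.domain, 0 < ((a : ℝ) * x 0 + b) / ((c : ℝ) * x 0 + e)) ∧
            (∀ x ∈ r.domain, (MvPolynomial.aeval
              ![x 0, (((a : ℝ) * x 0 + b) / ((c : ℝ) * x 0 + e)) ^ ((n : ℝ)⁻¹)] Q : ℝ) ≠ 0) ∧
            Set.EqOn r.integrand (fun x =>
              (MvPolynomial.aeval ![x 0, (((a : ℝ) * x 0 + b) / ((c : ℝ) * x 0 + e)) ^ ((n : ℝ)⁻¹)] P : ℝ) /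
                MvPolynomial.aeval ![x 0, (((a : ℝ) * x 0 + b) / ((c : ℝ) * x 0 + e)) ^ ((n : ℝ)⁻¹)] Q)
              r.domain ∧
            d = KZ.of r},
      ∃ ℓ ∈ AddSubgroup.closure
        {d : KZ.FormalRep | (∃ r : KZ.IntegralRep 0, d = KZ.of r) ∨
            ∃ (r : KZ.IntegralRep 1) (p q : Polynomial ℝ), (∀ i, IsAlgebraic ℚ (p.coeff i)) ∧
              (∀ i, IsAlgebraic ℚ (q.coeff i)) ∧ (∀ x ∈ r.domain, q.eval (x 0) ≠ 0) ∧
              Set.EqOn r.integrand (fun x => p.eval (x 0) / q.eval (x 0)) r.domain ∧ d = KZ.of r},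
      d - ℓ ∈ KZ.relations := by
  rintro d ⟨n, a, b, c, e, P, Q, r, hn, hdet, hpos, hQ, hint, rfl⟩
  obtain ⟨hψ, hid⟩ := tateLifting_rootChart n a b c e r.domain r.isSemialgebraic_domain hn hdet hpos
  set ψ : ℝ → ℝ := fun s => (((a : ℝ) * s + b) / ((c : ℝ) * s + e)) ^ ((n : ℝ)⁻¹) with hψ_def
  have haeX : ∀ t : ℝ,
      (Polynomial.aeval t (Polynomial.C e * Polynomial.X ^ n - Polynomial.C b :
        Polynomial (algebraicClosure ℚ ℝ)) : ℝ) = (e : ℝ) * t ^ n - b ∧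
      (Polynomial.aeval t (Polynomial.C a - Polynomial.C c * Polynomial.X ^ n :
        Polynomial (algebraicClosure ℚ ℝ)) : ℝ) = (a : ℝ) - c * t ^ n := fun t => by
    constructor <;>
      simp [Polynomial.aeval_def, Polynomial.eval₂_mul, Polynomial.eval₂_sub,
        IntermediateField.algebraMap_apply]
  have hq : ∀ x ∈ r.domain, (Polynomial.aeval (ψ (x 0))
      (Polynomial.C a - Polynomial.C c * Polynomial.X ^ n : Polynomial (algebraicClosure ℚ ℝ)) : ℝ) ≠ 0 :=
    fun x hx => by rw [(haeX _).2]; exact (hid x hx).1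
  have h1 : ∀ x ∈ r.domain,
      (Polynomial.aeval (ψ (x 0)) (1 : Polynomial (algebraicClosure ℚ ℝ)) : ℝ) ≠ 0 := fun x _ => by simp
  have hY : ∀ x ∈ r.domain, (Polynomial.aeval (ψ (x 0)) (Polynomial.X : Polynomial (algebraicClosure ℚ ℝ)) : ℝ) /
      Polynomial.aeval (ψ (x 0)) (1 : Polynomial (algebraicClosure ℚ ℝ)) = ψ (x 0) := fun x _ => by simp
  refine chart_reduce r ψ (Polynomial.C e * Polynomial.X ^ n - Polynomial.C b)
    (Polynomial.C a - Polynomial.C c * Polynomial.X ^ n) Polynomial.X 1 P Q hψ hq h1 (fun x hx => ?_)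
    (fun x hx => ?_) (fun x hx => ?_)
  · rw [(haeX _).1, (haeX _).2]; exact (hid x hx).2
  · rw [hY x hx]; exact hQ x hx
  · rw [hY x hx]; exact hint hx

/-- **Kernel transfer along reductions**: generator-wise reductions of `S` into `closure L` modulo relations and
the kernel form of Conjecture 1 on `closure L` give it on `closure S`. [cite: KontsevichZagier2001, §1.2] -/
theorem kernel_of_reduce {S L : Set KZ.FormalRep}
    (hred : ∀ d ∈ S, ∃ ℓ ∈ AddSubgroup.closure L, d - ℓ ∈ KZ.relations)
    (hL : ∀ c ∈ AddSubgroup.closure L, KZ.eval c = 0 → c ∈ KZ.relations) :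
    ∀ c ∈ AddSubgroup.closure S, KZ.eval c = 0 → c ∈ KZ.relations := by
  intro c hc hev
  classical
  rw [← Submodule.span_int_eq_addSubgroupClosure, Submodule.mem_toAddSubgroup,
    Submodule.mem_span_set'] at hc
  obtain ⟨k, f, g, rfl⟩ := hc
  choose ℓ hℓ hrel using fun i => hred (g i) (g i).2
  have hdiff : ∑ i, f i • ((g i : KZ.FormalRep)) - ∑ i, f i • ℓ i ∈ KZ.relations := by
    rw [← Finset.sum_sub_distrib]
    refine sum_mem fun i _ => ?_
    rw [← smul_sub]
    exact KZ.relations.zsmul_mem (hrel i) _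
  have hmem : ∑ i, f i • ℓ i ∈ AddSubgroup.closure L :=
    sum_mem fun i _ => AddSubgroup.zsmul_mem _ (hℓ i) _
  have hev' : KZ.eval (∑ i, f i • ℓ i) = 0 := by
    have h0 := KZ.relations_le_ker_eval_holds hdiff
    rw [AddMonoidHom.mem_ker, map_sub, hev, zero_sub, neg_eq_zero] at h0
    exact h0
  have h := KZ.relations.add_mem hdiff (hL _ hmem hev')
  rwa [sub_add_cancel] at h

/-- `x ↦ P(x₀, g(x))` is `ℚ`-semialgebraic on `τ` for `P ∈ K[X, Y]`, `g` semialgebraic. [cite: KontsevichZagier2001, §1.1] -/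
theorem isSemialgebraicFunOn_aeval_pair {τ : Set (Fin 1 → ℝ)} (hτ : IsSemialgebraic ℚ τ)
    {g : (Fin 1 → ℝ) → ℝ} (hg : IsSemialgebraicFunOn ℚ τ g)
    (P : MvPolynomial (Fin 2) (algebraicClosure ℚ ℝ)) :
    IsSemialgebraicFunOn ℚ τ (fun x => (MvPolynomial.aeval ![x 0, g x] P : ℝ)) := by
  induction P using MvPolynomial.induction_on with
  | C a =>
    exact (isSemialgebraicFunOn_const_of_isAlgebraic hτ (mem_algebraicClosure_iff.1 a.2)).congr fun z _ => by simp
  | add p q hp hq =>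
    refine (hp.fun_add hq).congr fun z _ => ?_
    simp
  | mul_X p i hp =>
    fin_cases i
    · refine (hp.fun_mul (isSemialgebraicFunOn_apply hτ 0)).congr fun z _ => ?_
      simp
    · refine (hp.fun_mul hg).congr fun z _ => ?_
      simp

/-- A conic arc `x ↦ P(x, √q(x))/Q(x, √q(x))` (`Q ≠ 0` on `τ`) is `ℚ`-semialgebraic on `τ`. [cite: KontsevichZagier2001, §1.1] -/
theorem isSemialgebraicFunOn_arc {τ : Set (Fin 1 → ℝ)} (hτ : IsSemialgebraic ℚ τ)
    (a b c : algebraicClosure ℚ ℝ) (P Q : MvPolynomial (Fin 2) (algebraicClosure ℚ ℝ)) {f : (Fin 1 → ℝ) → ℝ}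
    (hQ : ∀ x ∈ τ, (MvPolynomial.aeval ![x 0, Real.sqrt ((a : ℝ) * x 0 ^ 2 + (b : ℝ) * x 0 + c)] Q : ℝ) ≠ 0)
    (hf : ∀ x ∈ τ, f x =
      (MvPolynomial.aeval ![x 0, Real.sqrt ((a : ℝ) * x 0 ^ 2 + (b : ℝ) * x 0 + c)] P : ℝ) /
        MvPolynomial.aeval ![x 0, Real.sqrt ((a : ℝ) * x 0 ^ 2 + (b : ℝ) * x 0 + c)] Q) :
    IsSemialgebraicFunOn ℚ τ f := by
  have hsq : IsSemialgebraicFunOn ℚ τ (fun x => Real.sqrt ((a : ℝ) * x 0 ^ 2 + (b : ℝ) * x 0 + c)) := by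
    have hq : IsSemialgebraicFunOn ℚ τ (fun x => (a : ℝ) * x 0 ^ 2 + (b : ℝ) * x 0 + c) := by
      refine (isSemialgebraicFunOn_aeval_pair hτ (isSemialgebraicFunOn_apply hτ 0)
        (MvPolynomial.C a * MvPolynomial.X 0 ^ 2 + MvPolynomial.C b * MvPolynomial.X 0 + MvPolynomial.C c)).congr
        fun x _ => ?_
      simp [IntermediateField.algebraMap_apply]
    exact IsSemialgebraicFunOn.sqrt_holds hq
  exact ((isSemialgebraicFunOn_aeval_pair hτ hsq P).div (isSemialgebraicFunOn_aeval_pair hτ hsq Q)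
    hQ).congr fun x hx => (hf x hx).symm

end GenusZero

/-- **THE GENUS-ZERO SECTOR (kernel form).** Every vanishing `ℤ`-combination of point representations,
algebraic-coefficient rational representations of dimension one, CONIC representations `[σ, R(x, √q(x))]`
(`q = ax² + bx + c` over `K = ℚ̄ ∩ ℝ`, `q > 0` on `σ`) and RADICAL representations
`[σ, R(x, ⁿ√((ax+b)/(cx+e)))]` (`ae ≠ bc`, the radicand positive on `σ`) is a relation of the
Kontsevich–Zagier calculus: generator-wise reduction to the low-dimensional algebraic sector
(`GenusZero.conic_reduce` / `root_reduce`: Euler's secant substitution / the radical chart / piecewise rationality, each ONE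
rule-(2) or rule-(1) move along a `K`-rational chart) and `kzKernelConjecture_lowDimAlg` (Baker inside the
calculus). [cite: KontsevichZagier2001, §1.2] -/
theorem genusZeroLowDimKernel :
    ∀ c ∈ AddSubgroup.closure
        ({d : KZ.FormalRep | (∃ r : KZ.IntegralRep 0, d = KZ.of r) ∨
            ∃ (r : KZ.IntegralRep 1) (p q : Polynomial ℝ), (∀ i, IsAlgebraic ℚ (p.coeff i)) ∧
              (∀ i, IsAlgebraic ℚ (q.coeff i)) ∧ (∀ x ∈ r.domain, q.eval (x 0) ≠ 0) ∧
              Set.EqOn r.integrand (fun x => p.eval (x 0) / q.eval (x 0)) r.domain ∧ d = KZ.of r} ∪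
          {d : KZ.FormalRep | ∃ (a b c : algebraicClosure ℚ ℝ)
              (P Q : MvPolynomial (Fin 2) (algebraicClosure ℚ ℝ)) (r : KZ.IntegralRep 1),
            (∀ x ∈ r.domain, 0 < (a : ℝ) * x 0 ^ 2 + (b : ℝ) * x 0 + c) ∧
            (∀ x ∈ r.domain,
              (MvPolynomial.aeval ![x 0, Real.sqrt ((a : ℝ) * x 0 ^ 2 + (b : ℝ) * x 0 + c)] Q : ℝ) ≠ 0) ∧
            Set.EqOn r.integrand (fun x =>
              (MvPolynomial.aeval ![x 0, Real.sqrt ((a : ℝ) * x 0 ^ 2 + (b : ℝ) * x 0 + c)] P : ℝ) /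
                MvPolynomial.aeval ![x 0, Real.sqrt ((a : ℝ) * x 0 ^ 2 + (b : ℝ) * x 0 + c)] Q) r.domain ∧
            d = KZ.of r} ∪
          {d : KZ.FormalRep | ∃ (n : ℕ) (a b c e : algebraicClosure ℚ ℝ)
              (P Q : MvPolynomial (Fin 2) (algebraicClosure ℚ ℝ)) (r : KZ.IntegralRep 1),
            0 < n ∧ (a : ℝ) * e - b * c ≠ 0 ∧
            (∀ x ∈ r.domain, 0 < ((a : ℝ) * x 0 + b) / ((c : ℝ) * x 0 + e)) ∧
            (∀ x ∈ r.domain, (MvPolynomial.aeval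
              ![x 0, (((a : ℝ) * x 0 + b) / ((c : ℝ) * x 0 + e)) ^ ((n : ℝ)⁻¹)] Q : ℝ) ≠ 0) ∧
            Set.EqOn r.integrand (fun x =>
              (MvPolynomial.aeval ![x 0, (((a : ℝ) * x 0 + b) / ((c : ℝ) * x 0 + e)) ^ ((n : ℝ)⁻¹)] P : ℝ) /
                MvPolynomial.aeval ![x 0, (((a : ℝ) * x 0 + b) / ((c : ℝ) * x 0 + e)) ^ ((n : ℝ)⁻¹)] Q)
              r.domain ∧
            d = KZ.of r}),
      KZ.eval c = 0 → c ∈ KZ.relations := by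
  refine GenusZero.kernel_of_reduce (fun d hd => ?_) kzKernelConjecture_lowDimAlg
  rcases hd with (hd | hd) | hd
  · exact ⟨d, AddSubgroup.subset_closure hd, by rw [sub_self]; exact KZ.relations.zero_mem⟩
  · exact GenusZero.conic_reduce d hd
  · exact GenusZero.root_reduce d hd

end Summit.KontsevichZagierPeriods.InverseLandau

end
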